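import Literature.AlgebraicGeometry.Frobenioids.PadicKummerThm24iFrobenioidRel
import Literature.AlgebraicGeometry.Frobenioids.PadicKummerBaseCompatKernel
import Literature.AlgebraicGeometry.Frobenioids.PadicKummerRelCosetImEquiv
import HarnessLib

/-!
# Frobenioids II, Theorem 2.4 (i) over GENERAL bases `B^temp(Π, Π°)⁰`: the outer isomorphism `G₁ ⥲ G₂` and its compatibility
# with `Ψ` (`isoG`, `houter`) CONSTRUCTED from "`Ψ_Base` = `θ_*`, `θ : Π₁ ⥲ Π₂` over `G₁ ⥲ G₂`"

Mochizuki, *The geometry of Frobenioids II*, Kyushu J. Math. **62** (2008) 401–460, §2, Theorem 2.4 pp. 19–20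
[cite: MochizukiFrdII2008, Thm 2.4 (i) p.19]: "an equivalence of categories `Ψ : C₁ ⥲ C₂` — which … necessarily induces a
1-compatible equivalence of categories `Ψ_Base : D₁ ⥲ D₂`, hence an outer isomorphism of topological groups `Π₁ ⥲ Π₂` …
that lies over an outer isomorphism of topological groups `G₁ ⥲ G₂` [cf. Theorem 1.2, (ii)]. Assume that this isomorphism
`G₁ ⥲ G₂` maps `H₁` onto `H₂`. Then … (i) … `Ψ` … induces isomorphisms … `(G₁)_{A₁} ⥲ (G₂)_{A₂}` … compatible with the
respective Kummer and reciprocity maps".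

Sequel (seat abc-iut-L1-t7, gen 5) to `PadicKummerThm24iFrobenioidRel.lean` (Thm. 2.4 (i) over general §2 bases modulo
{hO, hbase, isoG/houter/map_H, hfs}), `PadicKummerBaseCompatKernel.lean` (hbase ⟸ "`Ψ_Base = θ_*`"),
`PadicKummerRelCosetGaloisConj.lean` (`G_{Kᵢ} ≅ Gal(ℚ̄_{pᵢ}/Kᵢ)`) and `PadicKummerRelCosetImEquiv.lean` (`G₁ ⥲ G₂` from `θ`).
From the printed structural data — `θ : Π₁ → Π₂` a continuous open surjective homomorphism over the `G`'s (`hkerθ`) and the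
1-compatibility `e : θ_*((A₁)_D) ≅ (Ψ A₁)_D` conjugating `Base(Ψα)` to `θ_*(Base α)` (`compat`) — this file CONSTRUCTS
* `isoGOfTheta : G_{K₁} ≃ₜ* G_{K₂}` — the representative of the outer isomorphism `G₁ ⥲ G₂` singled out by `e`
  (`G_{K₁} ≅ Gal(ℚ̄_{p₁}/K₁) ⥲ Gal(ℚ̄_{p₂}/K₂) —Inn(φ₂(c)⁻¹)→ Gal(ℚ̄_{p₂}/K₂) ≅ G_{K₂}`, `c·V₂ = e(1·θ(V₁))`),
and PROVES
* `houter_ofTheta` — its compatibility with `Ψ` on automorphisms through `G_{Kᵢ} ↠ Gal(Lᵢ/Kᵢ)` (the input `houter`),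
whence **`thm24i_ofFunctorRel_ofTheta`: Theorem 2.4 (i) for the `p`-adic Frobenioids over `Dᵢ = B^temp(Πᵢ, Πᵢ°)⁰`
(`Πᵢ → G_{ℚ_{pᵢ}}` any open homomorphisms) modulo EXACTLY {hO "`Ψ` preserves `O^⊳`" ([FrdI] Cor. 4.10/4.11), `θ`/`hkerθ`,
`e`/`compat` ("`Ψ_Base = θ_*` 1-compatibly" — the anabelian [Mzk2] Prop. 3.2 step, taken as input), map_H ("`G₁ ⥲ G₂` maps
`H₁` onto `H₂`", printed assumption), hfs (row L03)}** — the instance hypotheses `LocallyCompactSpace Hᵢ` being discharged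
(`locallyCompactSpace_H_contextOfObjectRel`). Classical Galois theory; nothing here concerns [IUTchIII]; no statement of the
paper is strengthened.
-/

noncomputable section

/-! ### Coset-category plumbing: points of conjugated endomorphisms -/

namespace Literature.AnabelianGeometry.SemiGraphs

namespace CosetCat

open CategoryTheory

universe u

variable {G : Type u} [Group G] [TopologicalSpace G]

/-- For an isomorphism `e : X ≅ Y` with `e(1) = c`, `e⁻¹(1) = c'`, one has `c' c ∈ Y.sg`. [cite: MochizukiFrdII2008, Thm 2.4 (i) p.19] -/
theorem rep_inv_mul_rep_mem {X Y : CosetCat G} (e : X ≅ Y) (c c' : G) (hc : (c : Y.carrier) = pt e.hom)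
    (hc' : (c' : X.carrier) = pt e.inv) : c' * c ∈ Y.sg := by
  have h : ((c' * c : G) : Y.carrier) = ((1 : G) : Y.carrier) := by
    rw [← pt_id, ← e.inv_hom_id, pt_comp, ← hc', toFun_coe, ← hc, MulAction.Quotient.smul_coe, smul_eq_mul]
  rw [QuotientGroup.eq, mul_one, inv_mem_iff] at h
  exact h

/-- The point of `e⁻¹ ≫ k ≫ e` is `c' t c` for `e(1) = c`, `e⁻¹(1) = c'`, `k(1) = t`. [cite: MochizukiFrdII2008, Thm 2.4 (i) p.19] -/
theorem coe_eq_pt_conj {X Y : CosetCat G} (e : X ≅ Y) (k : X ⟶ X) (c c' t : G) (hc : (c : Y.carrier) = pt e.hom)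
    (hc' : (c' : X.carrier) = pt e.inv) (ht : (t : X.carrier) = pt k) :
    ((c' * (t * c) : G) : Y.carrier) = pt (e.inv ≫ k ≫ e.hom) := by
  rw [pt_comp, ← hc', toFun_coe, pt_comp, ← ht, toFun_coe, ← hc, MulAction.Quotient.smul_coe, smul_eq_mul,
    MulAction.Quotient.smul_coe, smul_eq_mul]

/-- For `f : X ⟶ Y` with `f(1) = c`: `c⁻¹ u c ∈ Y.sg` for `u ∈ X.sg`. [cite: MochizukiFrdII2008, Thm 2.4 (i) p.19] -/
theorem conj_mem_of_mem {X Y : CosetCat G} (f : X ⟶ Y) (c : G) (hc : (c : Y.carrier) = pt f) {u : G} (hu : u ∈ X.sg) :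
    c⁻¹ * u * c ∈ Y.sg := by
  have h := smul_pt f (inv_mem hu)
  rw [← hc, MulAction.Quotient.smul_coe, smul_eq_mul, QuotientGroup.eq,
    show (u⁻¹ * c)⁻¹ * c = c⁻¹ * u * c by group] at h
  exact h

end CosetCat

end Literature.AnabelianGeometry.SemiGraphs

namespace Literature.AlgebraicGeometry.Frobenioids

namespace PadicFrd

namespace RelGal

open CategoryTheory Function Field IntermediateField Topology
open Literature.AnabelianGeometry.SemiGraphs QuasiTemperoid
open Literature.NumberTheory.GaloisRepresentations

/-! ### One chart: reading `res α = resGal L γ` on `K_A`, and inner automorphisms of `Gal(ℚ̄_p/K)` -/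

section OneChart

variable {p : ℕ} [Fact p.Prime] {P : Type} [Group P] [TopologicalSpace P]
  (φ₀ : P →* GalFbar ℚ_[p]) (hφ₀ : IsOpenHom φ₀) {P₀ : OpenSubgroup P}
  (d : Datum (RelCosetCat P₀) p) (hd : d.base = relBaseGal p P₀ φ₀ hφ₀) (A : d.frobenioid)

/-- `Gal(ℚ̄_p/K_A) = φ₀(V)` (`φ₀(V)` is open, hence closed; Krull). [cite: MochizukiFrdII2008, Rmk 2.2.1 p.18] -/
theorem fixingSubgroup_objFld :
    (objFld φ₀ hφ₀ d A).fixingSubgroup = (CosetCat.mapOpen φ₀ hφ₀.isOpenMap A.base.obj.sg).toSubgroup :=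
  haveI : IsGalois ℚ_[p] (Fbar ℚ_[p]) := {}
  InfiniteGalois.fixingSubgroup_fixedField ⟨(CosetCat.mapOpen φ₀ hφ₀.isOpenMap A.base.obj.sg).toSubgroup,
    Subgroup.isClosed_of_isOpen _ (CosetCat.mapOpen φ₀ hφ₀.isOpenMap A.base.obj.sg).isOpen⟩

/-- Values of `objLEquiv` in `K̄`: `ι⁻¹(b)`. [cite: MochizukiFrdII2008, Rmk 2.2.1 p.18] -/
theorem coe_objLEquiv_apply (b : ↥(objFldK φ₀ hφ₀ d A)) :
    ((objLEquiv φ₀ hφ₀ d A b : ↥(objL φ₀ hφ₀ d A)) : AlgebraicClosure (baseFld p φ₀ hφ₀)) =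
      (closureEquiv p φ₀ hφ₀).symm (b : Fbar ℚ_[p]) := rfl

/-- Values of `objLEquiv⁻¹` in `ℚ̄_p`: `ι(y)`. [cite: MochizukiFrdII2008, Rmk 2.2.1 p.18] -/
theorem coe_objLEquiv_symm_apply (y : ↥(objL φ₀ hφ₀ d A)) :
    (((objLEquiv φ₀ hφ₀ d A).symm y : ↥(objFldK φ₀ hφ₀ d A)) : Fbar ℚ_[p]) =
      closureEquiv p φ₀ hφ₀ (y : AlgebraicClosure (baseFld p φ₀ hφ₀)) := rfl

/-- **Reading `res α = resGal L γ` on `K_A`**: if the chart image of `α ∈ Aut_C(A)` is the restriction of `γ ∈ G_K`, then on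
`K_A ⊆ ℚ̄_p` the element `ι γ ι⁻¹ ∈ Gal(ℚ̄_p/K)` acts as `φ₀(π)` (`Base(α⁻¹)(1·V) = π·V`). [cite: MochizukiFrdII2008, Def 2.2 (i) p.17] -/
theorem coe_galConjBase_apply_eq_of_res_eq (hA : A.base.obj.sg.toSubgroup.Normal) {α : Aut A}
    {γ : absoluteGaloisGroup (baseFld p φ₀ hφ₀)}
    (hres : haveI := normal_objL φ₀ hφ₀ d A hA
      (galoisChartRel φ₀ hφ₀ d hd A hA).res α = resGal (objL φ₀ hφ₀ d A) γ)
    (π : P) (hπ : (π : A.base.obj.carrier) = CosetCat.pt (ModelFrobenioid.baseMap α.inv).hom)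
    {b : Fbar ℚ_[p]} (hb : b ∈ objFld φ₀ hφ₀ d A) :
    ((galConjBase p φ₀ hφ₀ γ : ↥(baseFld p φ₀ hφ₀).fixingSubgroup) : GalFbar ℚ_[p]) b = φ₀ π b := by
  haveI := normal_objL φ₀ hφ₀ d A hA
  let bb : ↥(objFldK φ₀ hφ₀ d A) := ⟨b, (mem_objFldK_iff φ₀ hφ₀ d A b).mpr hb⟩
  have h := congrArg (fun σ : ↥(objL φ₀ hφ₀ d A) ≃ₐ[baseFld p φ₀ hφ₀] ↥(objL φ₀ hφ₀ d A) =>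
    ((σ (objLEquiv φ₀ hφ₀ d A bb) : ↥(objL φ₀ hφ₀ d A)) : AlgebraicClosure (baseFld p φ₀ hφ₀))) hres
  rw [coe_resGal_apply] at h
  change ((objLEquiv φ₀ hφ₀ d A (resK φ₀ hφ₀ d A α ((objLEquiv φ₀ hφ₀ d A).symm (objLEquiv φ₀ hφ₀ d A bb))) :
      ↥(objL φ₀ hφ₀ d A)) : AlgebraicClosure (baseFld p φ₀ hφ₀)) = _ at h
  rw [AlgEquiv.symm_apply_apply, coe_objLEquiv_apply, coe_resK_apply φ₀ hφ₀ d A α π hπ, coe_objLEquiv_apply] at h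
  -- `h : ι⁻¹ (φ₀ π b) = γ • ι⁻¹ b`
  rw [coe_galConjBase_apply, ← h, AlgEquiv.apply_symm_apply]

/-- … hence `ι γ ι⁻¹ = φ₀(π v)` for some `v ∈ V` (`Gal(ℚ̄_p/K_A) = φ₀(V)`). [cite: MochizukiFrdII2008, Def 2.2 (i) p.17] -/
theorem exists_coe_galConjBase_eq_of_res_eq (hA : A.base.obj.sg.toSubgroup.Normal) {α : Aut A}
    {γ : absoluteGaloisGroup (baseFld p φ₀ hφ₀)}
    (hres : haveI := normal_objL φ₀ hφ₀ d A hA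
      (galoisChartRel φ₀ hφ₀ d hd A hA).res α = resGal (objL φ₀ hφ₀ d A) γ)
    (π : P) (hπ : (π : A.base.obj.carrier) = CosetCat.pt (ModelFrobenioid.baseMap α.inv).hom) :
    ∃ v ∈ A.base.obj.sg,
      ((galConjBase p φ₀ hφ₀ γ : ↥(baseFld p φ₀ hφ₀).fixingSubgroup) : GalFbar ℚ_[p]) = φ₀ (π * v) := by
  have hfix : (φ₀ π)⁻¹ * ((galConjBase p φ₀ hφ₀ γ : ↥(baseFld p φ₀ hφ₀).fixingSubgroup) : GalFbar ℚ_[p]) ∈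
      (objFld φ₀ hφ₀ d A).fixingSubgroup := by
    rw [IntermediateField.mem_fixingSubgroup_iff]
    intro b hb
    rw [AlgEquiv.mul_apply, coe_galConjBase_apply_eq_of_res_eq φ₀ hφ₀ d hd A hA hres π hπ hb, ← AlgEquiv.mul_apply,
      inv_mul_cancel, AlgEquiv.one_apply]
  rw [fixingSubgroup_objFld] at hfix
  obtain ⟨v, hv, hvπ⟩ := (CosetCat.mem_mapOpen φ₀ hφ₀.isOpenMap).mp hfix
  refine ⟨v, hv, ?_⟩
  rw [map_mul, hvπ, ← mul_assoc, mul_inv_cancel, one_mul]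

/-- The inner automorphism `x ↦ m⁻¹ x m` of `Gal(ℚ̄_p/K)` as a topological isomorphism (the "outer" ambiguity of
"`G ↠ Aut_E(A_E) ⥲ G_A`"). [cite: MochizukiFrdII2008, Def 2.2 (i) p.17] -/
def innerConj (m : ↥(baseFld p φ₀ hφ₀).fixingSubgroup) :
    ↥(baseFld p φ₀ hφ₀).fixingSubgroup ≃ₜ* ↥(baseFld p φ₀ hφ₀).fixingSubgroup where
  toFun x := m⁻¹ * x * m
  invFun x := m * x * m⁻¹
  left_inv x := by group
  right_inv x := by group
  map_mul' x y := by group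
  continuous_toFun := (continuous_const.mul continuous_id).mul continuous_const
  continuous_invFun := (continuous_const.mul continuous_id).mul continuous_const

/-- Values of `innerConj` on `ℚ̄_p`: `(m⁻¹ x m)(z) = m⁻¹(x(m z))`. [cite: MochizukiFrdII2008, Def 2.2 (i) p.17] -/
theorem coe_innerConj_apply (m x : ↥(baseFld p φ₀ hφ₀).fixingSubgroup) (z : Fbar ℚ_[p]) :
    ((innerConj φ₀ hφ₀ m x : ↥(baseFld p φ₀ hφ₀).fixingSubgroup) : GalFbar ℚ_[p]) z =
      ((m : GalFbar ℚ_[p]))⁻¹ ((x : GalFbar ℚ_[p]) ((m : GalFbar ℚ_[p]) z)) := rfl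

end OneChart

/-! ### `isoG` from `θ`, and `houter` -/

variable {p₁ p₂ : ℕ} [Fact p₁.Prime] [Fact p₂.Prime]
  {P₁ : Type} [Group P₁] [TopologicalSpace P₁] (φ₁ : P₁ →* GalFbar ℚ_[p₁]) (hφ₁ : IsOpenHom φ₁) {P₁₀ : OpenSubgroup P₁}
  {d₁ : Datum (RelCosetCat P₁₀) p₁} (hd₁ : d₁.base = relBaseGal p₁ P₁₀ φ₁ hφ₁)
  {P₂ : Type} [Group P₂] [TopologicalSpace P₂] (φ₂ : P₂ →* GalFbar ℚ_[p₂]) (hφ₂ : IsOpenHom φ₂) {P₂₀ : OpenSubgroup P₂}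
  {d₂ : Datum (RelCosetCat P₂₀) p₂} (hd₂ : d₂.base = relBaseGal p₂ P₂₀ φ₂ hφ₂)
  (F : d₁.frobenioid ⥤ d₂.frobenioid) {A₁ : d₁.frobenioid}
  (θ : P₁ →* P₂) (hθc : Continuous θ) (hθo : IsOpenMap θ) (hθs : Surjective θ)
  (hkerθ : ∀ x : P₁, φ₁ x = 1 ↔ φ₂ (θ x) = 1)
  (e : (CosetCat.push θ hθo).obj A₁.base.obj ≅ (F.obj A₁).base.obj)

/-- A representative `c ∈ Π₂` of `e(1·θ(V₁)) = c·V₂`. [cite: MochizukiFrdII2008, Thm 2.4 (i) p.19] -/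
def baseRep : P₂ := (QuotientGroup.mk_surjective (CosetCat.pt e.hom)).choose

/-- `c·V₂ = e(1·θ(V₁))`. [cite: MochizukiFrdII2008, Thm 2.4 (i) p.19] -/
theorem baseRep_spec : ((baseRep F θ hθo e : P₂) : (F.obj A₁).base.obj.carrier) = CosetCat.pt e.hom :=
  (QuotientGroup.mk_surjective (CosetCat.pt e.hom)).choose_spec

/-- **The representative of the outer isomorphism `G₁ ⥲ G₂` singled out by `e`**, on absolute Galois groups:
`G_{K₁} ≅ Gal(ℚ̄_{p₁}/K₁) ⥲ Gal(ℚ̄_{p₂}/K₂) —Inn(φ₂(c)⁻¹)→ Gal(ℚ̄_{p₂}/K₂) ≅ G_{K₂}`. [cite: MochizukiFrdII2008, Thm 2.4 (i) p.19] -/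
def isoGOfTheta : absoluteGaloisGroup (baseFld p₁ φ₁ hφ₁) ≃ₜ* absoluteGaloisGroup (baseFld p₂ φ₂ hφ₂) :=
  (galConjBase p₁ φ₁ hφ₁).trans ((imEquiv φ₁ hφ₁ φ₂ hφ₂ θ hkerθ hθc hθo hθs).trans
    ((innerConj φ₂ hφ₂ (toIm φ₂ hφ₂ (baseRep F θ hθo e))).trans (galConjBase p₂ φ₂ hφ₂).symm))

/-- The action of `isoGOfTheta γ` on `K̄₂`: `ι₂⁻¹ ∘ φ₂(c)⁻¹ ∘ g(ι₁ γ ι₁⁻¹) ∘ φ₂(c) ∘ ι₂`, `g : G₁ ⥲ G₂` the isomorphism over which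
`θ` lies. [cite: MochizukiFrdII2008, Thm 2.4 (i) p.19] -/
theorem isoGOfTheta_smul (γ : absoluteGaloisGroup (baseFld p₁ φ₁ hφ₁)) (y : AlgebraicClosure (baseFld p₂ φ₂ hφ₂)) :
    isoGOfTheta φ₁ hφ₁ φ₂ hφ₂ F θ hθc hθo hθs hkerθ e γ • y =
      (closureEquiv p₂ φ₂ hφ₂).symm ((φ₂ (baseRep F θ hθo e))⁻¹
        (((imEquiv φ₁ hφ₁ φ₂ hφ₂ θ hkerθ hθc hθo hθs (galConjBase p₁ φ₁ hφ₁ γ) :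
            ↥(baseFld p₂ φ₂ hφ₂).fixingSubgroup) : GalFbar ℚ_[p₂])
          (φ₂ (baseRep F θ hθo e) (closureEquiv p₂ φ₂ hφ₂ y)))) := by
  rw [isoGOfTheta, ContinuousMulEquiv.trans_apply, ContinuousMulEquiv.trans_apply, ContinuousMulEquiv.trans_apply,
    galConjBase_symm_apply_apply, coe_innerConj_apply]
  rfl

variable (hA₁ : A₁.base.obj.sg.toSubgroup.Normal) (hA₂ : (F.obj A₁).base.obj.sg.toSubgroup.Normal)
  (compat : ∀ α : Aut A₁, (ModelFrobenioid.baseMap (F.mapIso α).inv).hom =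
    e.inv ≫ (CosetCat.push θ hθo).map (ModelFrobenioid.baseMap α.inv).hom ≫ e.hom)

/-- **The key identity**: on `z ∈ K_{A₂}`, `φ₂(c' θπ c) = φ₂(c)⁻¹ φ₂(θπ) φ₂(u) φ₂(c)` whenever `c' c ∈ V₂` and
`c⁻¹ u c ∈ V₂` (`V₂ ⊴ Π₂`; the `V₂`-terms act trivially on `K_{A₂}`). [cite: MochizukiFrdII2008, Thm 2.4 (i) p.19] -/
theorem key_identity (hA₂ : (F.obj A₁).base.obj.sg.toSubgroup.Normal) (c c' π₂ u : P₂) (hcc : c' * c ∈ (F.obj A₁).base.obj.sg) (hu : c⁻¹ * u * c ∈ (F.obj A₁).base.obj.sg)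
    {z : Fbar ℚ_[p₂]} (hz : z ∈ objFld φ₂ hφ₂ d₂ (F.obj A₁)) :
    φ₂ (c' * (π₂ * c)) z = (φ₂ c)⁻¹ (φ₂ π₂ (φ₂ u (φ₂ c z))) := by
  -- `φ₂(u) φ₂(c) z = φ₂(c) z`
  have h1 : φ₂ u (φ₂ c z) = φ₂ c z := by
    have : φ₂ u (φ₂ c z) = φ₂ c (φ₂ (c⁻¹ * u * c) z) := by
      rw [← AlgEquiv.mul_apply, ← map_mul, ← AlgEquiv.mul_apply, ← map_mul,
        show c * (c⁻¹ * u * c) = u * c by group]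
    rw [this, (mem_objFld_iff φ₂ hφ₂ d₂ (F.obj A₁) z).mp hz _ hu]
  -- `φ₂(c' θπ c) z = φ₂(c'c) (φ₂(c⁻¹ θπ c) z) = φ₂(c⁻¹ θπ c) z`
  have hw : φ₂ (c⁻¹ * π₂ * c) z ∈ objFld φ₂ hφ₂ d₂ (F.obj A₁) := map_mem_objFld φ₂ hφ₂ d₂ (F.obj A₁) hA₂ _ hz
  have h2 : φ₂ (c' * (π₂ * c)) z = φ₂ (c⁻¹ * π₂ * c) z := by
    rw [show c' * (π₂ * c) = (c' * c) * (c⁻¹ * π₂ * c) by group, map_mul, AlgEquiv.mul_apply,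
      (mem_objFld_iff φ₂ hφ₂ d₂ (F.obj A₁) _).mp hw _ hcc]
  rw [h2, h1, map_mul, map_mul, map_inv, AlgEquiv.mul_apply, AlgEquiv.mul_apply]

/-- **`houter` for `isoGOfTheta`** (the input of `thm24i_ofFunctorRel`): the representative of `G₁ ⥲ G₂` singled out by `e`
is compatible with `Ψ` on automorphisms through the outer homomorphisms `G_{Kᵢ} ↠ Gal(Lᵢ/Kᵢ)` — for `α` lifting `γ|_{L₁}`,
`(Ψα)|_{L₂} = (isoG γ)|_{L₂}`. [cite: MochizukiFrdII2008, Thm 2.4 (i) p.19] -/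
theorem houter_ofTheta [F.Full] [F.Faithful] :
    haveI := normal_objL φ₁ hφ₁ d₁ A₁ hA₁; haveI := normal_objL φ₂ hφ₂ d₂ (F.obj A₁) hA₂
    ∀ γ : absoluteGaloisGroup (baseFld p₁ φ₁ hφ₁),
      resGal (objL φ₂ hφ₂ d₂ (F.obj A₁)) (isoGOfTheta φ₁ hφ₁ φ₂ hφ₂ F θ hθc hθo hθs hkerθ e γ) =
        PadicFrd.Datum.GaloisChart.galEquivKer F (galoisChartRel φ₁ hφ₁ d₁ hd₁ A₁ hA₁)
          (galoisChartRel φ₂ hφ₂ d₂ hd₂ (F.obj A₁) hA₂)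
          (PadicKummer.Def22Context.res_eq_one_iff_autEquiv_of_push hd₁ hd₂ F hA₁ hA₂
            (hbase_of_pushCompat φ₁ hφ₁ φ₂ hφ₂ F θ hθo hkerθ e compat))
          (resGal (objL φ₁ hφ₁ d₁ A₁) γ) := by
  haveI := normal_objL φ₁ hφ₁ d₁ A₁ hA₁; haveI := normal_objL φ₂ hφ₂ d₂ (F.obj A₁) hA₂
  apply PadicFrd.Datum.GaloisChart.houter_of_compat_ker
  intro γ α hres
  -- representatives
  obtain ⟨π, hπ⟩ := exists_coe_eq_pt d₁ A₁ (ModelFrobenioid.baseMap α.inv).hom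
  obtain ⟨v₁, hv₁, hγ⟩ := exists_coe_galConjBase_eq_of_res_eq φ₁ hφ₁ d₁ hd₁ A₁ hA₁ hres π hπ
  set c := baseRep F θ hθo e with hcdef
  obtain ⟨c', hc'⟩ := QuotientGroup.mk_surjective (CosetCat.pt e.inv)
  have hc : ((c : P₂) : (F.obj A₁).base.obj.carrier) = CosetCat.pt e.hom := baseRep_spec F θ hθo e
  -- the representative of `Base((Ψα)⁻¹)(1·V₂)`
  have hθπ : ((θ π : P₂) : ((CosetCat.push θ hθo).obj A₁.base.obj).carrier) =
      CosetCat.pt ((CosetCat.push θ hθo).map (ModelFrobenioid.baseMap α.inv).hom) := by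
    rw [CosetCat.pt_push_map, ← hπ, CosetCat.pushQuot_coe]
  have hπ' : ((c' * (θ π * c) : P₂) : (F.obj A₁).base.obj.carrier) =
      CosetCat.pt (ModelFrobenioid.baseMap (PadicFrd.Datum.GaloisChart.autEquiv F α).inv).hom := by
    rw [PadicFrd.Datum.GaloisChart.autEquiv_apply, compat α]
    exact CosetCat.coe_eq_pt_conj e _ c c' (θ π) hc hc' hθπ
  -- the `V₂`-memberships
  have hcc : c' * c ∈ (F.obj A₁).base.obj.sg := CosetCat.rep_inv_mul_rep_mem e c c' hc hc'
  have hu : c⁻¹ * θ v₁ * c ∈ (F.obj A₁).base.obj.sg :=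
    CosetCat.conj_mem_of_mem e.hom c hc ((CosetCat.mem_mapOpen θ hθo).mpr ⟨v₁, hv₁, rfl⟩)
  -- compare on `y ∈ L₂`
  apply AlgEquiv.ext
  intro y
  apply Subtype.ext
  have hy : closureEquiv p₂ φ₂ hφ₂ (y : AlgebraicClosure (baseFld p₂ φ₂ hφ₂)) ∈ objFld φ₂ hφ₂ d₂ (F.obj A₁) := by
    have hy2 : ∃ x ∈ objFldK φ₂ hφ₂ d₂ (F.obj A₁), (closureEquiv p₂ φ₂ hφ₂).symm.toAlgHom x = y := y.2
    obtain ⟨x, hx, hxy⟩ := hy2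
    rw [← hxy]
    change closureEquiv p₂ φ₂ hφ₂ ((closureEquiv p₂ φ₂ hφ₂).symm x) ∈ _
    rw [AlgEquiv.apply_symm_apply]
    exact (mem_objFldK_iff φ₂ hφ₂ d₂ (F.obj A₁) x).mp hx
  rw [coe_resGal_apply, isoGOfTheta_smul,
    coe_imEquiv_of_eq φ₁ hφ₁ φ₂ hφ₂ θ hkerθ hθc hθo hθs _ (π * v₁) hγ.symm, map_mul, map_mul, AlgEquiv.mul_apply,
    ← key_identity φ₂ hφ₂ F hA₂ c c' (θ π) (θ v₁) hcc hu hy]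
  -- the chart side
  change ((objLEquiv φ₂ hφ₂ d₂ (F.obj A₁) (resK φ₂ hφ₂ d₂ (F.obj A₁) (PadicFrd.Datum.GaloisChart.autEquiv F α)
      ((objLEquiv φ₂ hφ₂ d₂ (F.obj A₁)).symm y)) : ↥(objL φ₂ hφ₂ d₂ (F.obj A₁))) :
      AlgebraicClosure (baseFld p₂ φ₂ hφ₂)) = _
  rw [coe_objLEquiv_apply, coe_resK_apply φ₂ hφ₂ d₂ (F.obj A₁) _ _ hπ', coe_objLEquiv_symm_apply]

end RelGal

end PadicFrd

/-! ### Theorem 2.4 (i) over general bases from `θ` -/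

namespace PadicKummer.Def22Context

open CategoryTheory Field IntermediateField Kummer Function
open Literature.NumberTheory.GaloisRepresentations
open Literature.AnabelianGeometry.SemiGraphs QuasiTemperoid PadicFrd PadicFrd.Datum PadicFrd.Datum.GaloisChart PadicFrd.RelGal

variable {p₁ p₂ : ℕ} [Fact p₁.Prime] [Fact p₂.Prime]
  {P₁ : Type} [Group P₁] [TopologicalSpace P₁] {φ₁ : P₁ →* GalFbar ℚ_[p₁]} {hφ₁ : IsOpenHom φ₁} {P₁₀ : OpenSubgroup P₁}
  {d₁ : PadicFrd.Datum (RelCosetCat P₁₀) p₁} (hd₁ : d₁.base = relBaseGal p₁ P₁₀ φ₁ hφ₁)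
  {P₂ : Type} [Group P₂] [TopologicalSpace P₂] {φ₂ : P₂ →* GalFbar ℚ_[p₂]} {hφ₂ : IsOpenHom φ₂} {P₂₀ : OpenSubgroup P₂}
  {d₂ : PadicFrd.Datum (RelCosetCat P₂₀) p₂} (hd₂ : d₂.base = relBaseGal p₂ P₂₀ φ₂ hφ₂)
  (F : d₁.frobenioid ⥤ d₂.frobenioid) [F.Full] [F.Faithful] {A₁ : d₁.frobenioid}
  (hA₁ : A₁.base.obj.sg.toSubgroup.Normal) (hA₂ : (F.obj A₁).base.obj.sg.toSubgroup.Normal)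
  (hO : ∀ f : A₁ ⟶ A₁, f ∈ PreFrobenioid.endSubmonoid d₁.structureFunctor A₁ ↔
    F.map f ∈ PreFrobenioid.endSubmonoid d₂.structureFunctor (F.obj A₁))
  (θ : P₁ →* P₂) (hθc : Continuous θ) (hθo : IsOpenMap θ) (hθs : Surjective θ)
  (hkerθ : ∀ x : P₁, φ₁ x = 1 ↔ φ₂ (θ x) = 1)
  (e : (CosetCat.push θ hθo).obj A₁.base.obj ≅ (F.obj A₁).base.obj)
  (compat : ∀ α : Aut A₁, (ModelFrobenioid.baseMap (F.mapIso α).inv).hom =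
    e.inv ≫ (CosetCat.push θ hθo).map (ModelFrobenioid.baseMap α.inv).hom ≫ e.hom)
  {H₁ : Subgroup (absoluteGaloisGroup (baseFld p₁ φ₁ hφ₁))} [H₁.Normal]
  {hH₁ : IsOpen (H₁ : Set (absoluteGaloisGroup (baseFld p₁ φ₁ hφ₁)))}
  {H₂ : Subgroup (absoluteGaloisGroup (baseFld p₂ φ₂ hφ₂))} [H₂.Normal]
  {hH₂ : IsOpen (H₂ : Set (absoluteGaloisGroup (baseFld p₂ φ₂ hφ₂)))}
  (map_H : H₁.map (isoGOfTheta φ₁ hφ₁ φ₂ hφ₂ F θ hθc hθo hθs hkerθ e).toMulEquiv.toMonoidHom = H₂)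
  (N : ℕ) [NeZero N]
  (hμ₁ : ∀ ζ : rootsOfUnity N (AlgebraicClosure (baseFld p₁ φ₁ hφ₁)),
    ((ζ : (AlgebraicClosure (baseFld p₁ φ₁ hφ₁))ˣ) : AlgebraicClosure (baseFld p₁ φ₁ hφ₁)) ∈ objL φ₁ hφ₁ d₁ A₁)
  (hμ₂ : ∀ ζ : rootsOfUnity N (AlgebraicClosure (baseFld p₂ φ₂ hφ₂)),
    ((ζ : (AlgebraicClosure (baseFld p₂ φ₂ hφ₂))ˣ) : AlgebraicClosure (baseFld p₂ φ₂ hφ₂)) ∈ objL φ₂ hφ₂ d₂ (F.obj A₁))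

/-- **The isomorphism of Definition 2.2 contexts of `A₁`, `Ψ A₁` induced by `Ψ`, from `θ`** (`isoOfFunctorRel` with
`hbase := hbase_of_pushCompat`, `isoG := isoGOfTheta`, `houter := houter_ofTheta`). [cite: MochizukiFrdII2008, Thm 2.4 (i) p.19] -/
def isoOfFunctorRelTheta :
    (contextOfObjectRel φ₁ hφ₁ d₁ hd₁ A₁ hA₁ H₁ hH₁).Iso (contextOfObjectRel φ₂ hφ₂ d₂ hd₂ (F.obj A₁) hA₂ H₂ hH₂) :=
  isoOfFunctorRel hd₁ hd₂ F hA₁ hA₂ hO (hbase_of_pushCompat φ₁ hφ₁ φ₂ hφ₂ F θ hθo hkerθ e compat)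
    (isoGOfTheta φ₁ hφ₁ φ₂ hφ₂ F θ hθc hθo hθs hkerθ e)
    (houter_ofTheta φ₁ hφ₁ hd₁ φ₂ hφ₂ hd₂ F θ hθc hθo hθs hkerθ e hA₁ hA₂ compat) map_H

/-- **[FrdII] Theorem 2.4 (i) for the `p`-adic Frobenioids over GENERAL bases `Dᵢ = B^temp(Πᵢ, Πᵢ°)⁰` of §2, from the printed
structural data.** For `Ψ : C₁ ⥤ C₂` fully faithful, an object `A₁` with `(A₁)_D`, `(Ψ A₁)_D` Galois, `μ_N(K̄ᵢ) ⊆ Lᵢ ≅ K_{Aᵢ}`,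
`A₁` `(N, H₁)`-saturated, any normalisation `F_N(A₁) ≅ ℤ/N`, and BY NAME: "`Ψ` preserves `O^⊳(−)`" (`hO`, [FrdI]
Cor. 4.10/4.11); a continuous open surjective `θ : Π₁ ↠ Π₂` over the `G`'s (`hkerθ`) with `Ψ_Base = θ_*` 1-compatibly at `A₁`
(`e`, `compat`; print: "`Ψ_Base` … hence an outer isomorphism `Π₁ ⥲ Π₂` [[Mzk2] Prop. 3.2] that lies over … `G₁ ⥲ G₂`");
"this isomorphism `G₁ ⥲ G₂` maps `H₁` onto `H₂`" (`map_H`, for the representative `isoGOfTheta`); "`Φ₁` fieldwise saturated iff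
`Φ₂`" (`hfs`) — the typed `Thm24i` holds for the contexts of `A₁`, `Ψ A₁`, the comparison data induced by `Ψ`, and the
cup-product duality isomorphisms; `isoG`, `houter`, `hbase`, `p₁ = p₂`, local compactness of `Hᵢ`, the saturation transfer
and the Kummer/reciprocity compatibilities are all CONSTRUCTED or PROVED. [cite: MochizukiFrdII2008, Thm 2.4 (i) p.19] -/
theorem thm24i_ofFunctorRel_ofTheta (fs₁ fs₂ : Prop) (hfs : fs₁ ↔ fs₂)
    (eFN₁ : FN (contextOfObjectRel φ₁ hφ₁ d₁ hd₁ A₁ hA₁ H₁ hH₁) N ≃+ ZMod N)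
    (hc₁ : IsNHSaturated (contextOfObjectRel φ₁ hφ₁ d₁ hd₁ A₁ hA₁ H₁ hH₁) N) :
    haveI := finiteDimensional_objL φ₁ hφ₁ d₁ A₁; haveI := normal_objL φ₁ hφ₁ d₁ A₁ hA₁
    haveI := finiteDimensional_objL φ₂ hφ₂ d₂ (F.obj A₁); haveI := normal_objL φ₂ hφ₂ d₂ (F.obj A₁) hA₂
    haveI := finiteDimensional_baseFld p₁ φ₁ hφ₁; haveI := finiteDimensional_baseFld p₂ φ₂ hφ₂
    haveI := locallyCompactSpace_H_contextOfObjectRel φ₁ hφ₁ d₁ hd₁ A₁ hA₁ H₁ hH₁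
    haveI := locallyCompactSpace_H_contextOfObjectRel φ₂ hφ₂ d₂ hd₂ (F.obj A₁) hA₂ H₂ hH₂
    letI := (galoisChartRel φ₁ hφ₁ d₁ hd₁ A₁ hA₁).galAction
    letI := (galoisChartRel φ₂ hφ₂ d₂ hd₂ (F.obj A₁) hA₂).galAction
    Thm24i (contextOfObjectRel φ₁ hφ₁ d₁ hd₁ A₁ hA₁ H₁ hH₁) (contextOfObjectRel φ₂ hφ₂ d₂ hd₂ (F.obj A₁) hA₂ H₂ hH₂)
      N p₁ p₂ fs₁ fs₂
      ((isoOfFunctorRelTheta hd₁ hd₂ F hA₁ hA₂ hO θ hθc hθo hθs hkerθ e compat map_H).thm24Data N)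
      ((contextOfObjectRel φ₁ hφ₁ d₁ hd₁ A₁ hA₁ H₁ hH₁).dualityIsoOfLocalDuality N eFN₁ hc₁
        (cupDualH_bijective_ofGalois_mlf p₁ (objL φ₁ hφ₁ d₁ A₁) H₁ hH₁ (galoisChartRel φ₁ hφ₁ d₁ hd₁ A₁ hA₁).res
          (galoisChartRel φ₁ hφ₁ d₁ hd₁ A₁ hA₁).res_smul ((galoisChartRel φ₁ hφ₁ d₁ hd₁ A₁ hA₁).muModel N hμ₁)))
      ((contextOfObjectRel φ₂ hφ₂ d₂ hd₂ (F.obj A₁) hA₂ H₂ hH₂).dualityIsoOfLocalDuality N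
        (((isoOfFunctorRelTheta hd₁ hd₂ F hA₁ hA₂ hO θ hθc hθo hθs hkerθ e compat map_H).isoFN N).symm.trans eFN₁)
        (((isoOfFunctorRelTheta hd₁ hd₂ F hA₁ hA₂ hO θ hθc hθo hθs hkerθ e compat map_H).isNHSaturated_iff N).mp hc₁)
        (cupDualH_bijective_ofGalois_mlf p₂ (objL φ₂ hφ₂ d₂ (F.obj A₁)) H₂ hH₂
          (galoisChartRel φ₂ hφ₂ d₂ hd₂ (F.obj A₁) hA₂).res (galoisChartRel φ₂ hφ₂ d₂ hd₂ (F.obj A₁) hA₂).res_smul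
          ((galoisChartRel φ₂ hφ₂ d₂ hd₂ (F.obj A₁) hA₂).muModel N hμ₂))) :=
  haveI := locallyCompactSpace_H_contextOfObjectRel φ₁ hφ₁ d₁ hd₁ A₁ hA₁ H₁ hH₁
  haveI := locallyCompactSpace_H_contextOfObjectRel φ₂ hφ₂ d₂ hd₂ (F.obj A₁) hA₂ H₂ hH₂
  thm24i_ofFunctorRel hd₁ hd₂ F hA₁ hA₂ hO (hbase_of_pushCompat φ₁ hφ₁ φ₂ hφ₂ F θ hθo hkerθ e compat)
    (isoGOfTheta φ₁ hφ₁ φ₂ hφ₂ F θ hθc hθo hθs hkerθ e)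
    (houter_ofTheta φ₁ hφ₁ hd₁ φ₂ hφ₂ hd₂ F θ hθc hθo hθs hkerθ e hA₁ hA₂ compat) map_H N hμ₁ hμ₂
    fs₁ fs₂ hfs eFN₁ hc₁

end PadicKummer.Def22Context

end Literature.AlgebraicGeometry.Frobenioids

end
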